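import Summits.Schanuel.Schanuel.Theorems.ZilberEacExpExpRootLemmas
import Summits.Schanuel.Schanuel.Theorems.ZilberEacMovingGraph
import HarnessLib

/-!
# The pure moving target `e^{z} = A(z)` over graph bases: lemmas (second-order expansion)

Zilber's Exponential-Algebraic Closedness, case ladder (host summit Schanuel, cell `pub-schanuel`,
seat 2, gen 8).  For `ZilberEacMovingGraphPure`: the exponential points of
`{x₁ = p(x₀), y₀ = A(x₀)}` (`deg p = D ≥ 2`, `deg A ≥ 1`) are the `(x, p(x), A(x), e^{p(x)})` over the
roots `x = u + it` of `e^{x} = A(x)` (`u = d log M + O(1)`, `t = 2πM + O(1)`), and THEOREM G needs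
`|Re p(x)| / log ‖p(x)‖ → ∞` whatever the signs.  The second-order expansion proved here,

  `Re p(u + it) = Re(lc·i^D) t^D + (Re(p_{D-1} i^{D-1}) + D Re(lc·i^{D-1}) u) t^{D-1} + O((1+u)² t^{D-2})`

(`re_eval_near_lattice`, from the quadratic Taylor remainder `norm_eval_add_sub_sub_le` and the
two-leading-terms decomposition `exists_bound_two_leading`), gives `|Re p(x)| ≳ t^D` if
`Re(lc i^D) ≠ 0` and `≳ u t^{D-1}` otherwise (`re_leadingCoeff_mul_I_pow_pred_ne_zero`: then
`lc i^{D-1}` is a nonzero real).  Also `eventually_mul_log_add_sq_le`: `(a log m + b)² ≤ δ m` eventually.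

HONEST FRAMING: auxiliary analysis; nothing here bears on Schanuel's conjecture; EAC ⇏ SC.
-/

noncomputable section

open Complex Filter Topology
open Literature.ModelTheory.Zilber

set_option linter.dupNamespace false

namespace Summit.Schanuel.Schanuel.Theorems

/-- **Two leading terms.**  For `deg p = D ≥ 2` there is `B ≥ 0` with
`‖p(a) - lc a^D - p_{D-1} a^{D-1}‖ ≤ B ‖a‖^{D-2}` and `‖p'(a) - D lc a^{D-1}‖ ≤ B ‖a‖^{D-2}` for
`‖a‖ ≥ 1`. [folklore] -/
theorem exists_bound_two_leading (p : Polynomial ℂ) (hD : 2 ≤ p.natDegree) :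
    ∃ B : ℝ, 0 ≤ B ∧ ∀ a : ℂ, 1 ≤ ‖a‖ →
      ‖p.eval a - p.leadingCoeff * a ^ p.natDegree -
          p.coeff (p.natDegree - 1) * a ^ (p.natDegree - 1)‖ ≤ B * ‖a‖ ^ (p.natDegree - 2) ∧
      ‖p.derivative.eval a - p.natDegree * p.leadingCoeff * a ^ (p.natDegree - 1)‖ ≤
          B * ‖a‖ ^ (p.natDegree - 2) := by
  set D : ℕ := p.natDegree with hDdef
  set α : ℂ := p.leadingCoeff with hα
  -- `q₂ = p - lc X^D - p_{D-1} X^{D-1}`, `q = p' - D lc X^{D-1}`, both of degree `≤ D - 2`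
  set q₂ : Polynomial ℂ := p - Polynomial.C α * Polynomial.X ^ D -
    Polynomial.C (p.coeff (D - 1)) * Polynomial.X ^ (D - 1) with hq₂
  set q : Polynomial ℂ := p.derivative - Polynomial.C ((D : ℂ) * α) * Polynomial.X ^ (D - 1) with hq
  have hq₂deg : q₂.natDegree ≤ D - 2 := by
    rw [Polynomial.natDegree_le_iff_coeff_eq_zero]
    intro N hN
    simp only [hq₂, Polynomial.coeff_sub, Polynomial.coeff_C_mul, Polynomial.coeff_X_pow]
    by_cases h1 : N = D - 1
    · rw [if_neg (by omega), if_pos h1, h1]; ring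
    · by_cases h2 : N = D
      · rw [if_pos h2, if_neg h1, h2, hα, Polynomial.leadingCoeff, ← hDdef]; ring
      · rw [if_neg h2, if_neg h1, Polynomial.coeff_eq_zero_of_natDegree_lt (by omega)]; ring
  have hqdeg : q.natDegree ≤ D - 2 := by
    rw [Polynomial.natDegree_le_iff_coeff_eq_zero]
    intro N hN
    rw [hq, Polynomial.coeff_sub, Polynomial.coeff_C_mul, Polynomial.coeff_X_pow,
      Polynomial.coeff_derivative]
    by_cases hN1 : N = D - 1
    · rw [if_pos hN1, hN1, show D - 1 + 1 = D by omega, hα, Polynomial.leadingCoeff, ← hDdef]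
      push_cast [show 1 ≤ D by omega]
      ring
    · rw [if_neg hN1, mul_zero, sub_zero, Polynomial.coeff_eq_zero_of_natDegree_lt (by omega),
        zero_mul]
  refine ⟨max (coeffNormSum q₂) (coeffNormSum q), (coeffNormSum_nonneg _).trans (le_max_left _ _),
    fun a ha => ⟨?_, ?_⟩⟩
  · have he : p.eval a - α * a ^ D - p.coeff (D - 1) * a ^ (D - 1) = q₂.eval a := by
      simp only [hq₂, Polynomial.eval_sub, Polynomial.eval_mul, Polynomial.eval_C,
        Polynomial.eval_pow, Polynomial.eval_X]
    rw [he]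
    exact (norm_eval_le_of_natDegree_le q₂ ha le_rfl hq₂deg).trans
      (mul_le_mul_of_nonneg_right (le_max_left _ _) (by positivity))
  · have he : p.derivative.eval a - (D : ℂ) * α * a ^ (D - 1) = q.eval a := by
      simp only [hq, Polynomial.eval_sub, Polynomial.eval_mul, Polynomial.eval_C,
        Polynomial.eval_pow, Polynomial.eval_X]
    rw [he]
    exact (norm_eval_le_of_natDegree_le q ha le_rfl hqdeg).trans
      (mul_le_mul_of_nonneg_right (le_max_right _ _) (by positivity))

/-- **Second-order expansion of `Re p(u + it)`** (`deg p = D ≥ 2`): there is `B ≥ 0` such that for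
`1 ≤ t`, `0 ≤ u ≤ t`,
`|Re p(u+it) - (Re(lc i^D) t^D + (Re(p_{D-1} i^{D-1}) + D Re(lc i^{D-1}) u) t^{D-1})| ≤ B (1+u)² t^{D-2}`.
[folklore] -/
theorem re_eval_near_lattice (p : Polynomial ℂ) (hD : 2 ≤ p.natDegree) :
    ∃ B : ℝ, 0 ≤ B ∧ ∀ u t : ℝ, 1 ≤ t → 0 ≤ u → u ≤ t →
      |(p.eval ((u : ℂ) + t * I)).re -
        ((p.leadingCoeff * I ^ p.natDegree).re * t ^ p.natDegree +
          ((p.coeff (p.natDegree - 1) * I ^ (p.natDegree - 1)).re +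
            p.natDegree * (p.leadingCoeff * I ^ (p.natDegree - 1)).re * u) * t ^ (p.natDegree - 1))|
        ≤ B * (1 + u) ^ 2 * t ^ (p.natDegree - 2) := by
  set D : ℕ := p.natDegree with hDdef
  set α : ℂ := p.leadingCoeff with hα
  set p₁ : ℂ := p.coeff (D - 1) with hp₁
  obtain ⟨B, hB0, hB⟩ := exists_bound_two_leading p hD
  set B₂ : ℝ := coeffNormSum p.derivative * ((D - 2 : ℕ) + 1) * 2 ^ (D - 2) with hB₂
  have hB₂0 : 0 ≤ B₂ := by have := coeffNormSum_nonneg p.derivative; positivity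
  refine ⟨B + B + B₂, by positivity, fun u t ht hu hut => ?_⟩
  set a : ℂ := (t : ℂ) * I with ha
  have ha_norm : ‖a‖ = t := by
    rw [ha, norm_mul, Complex.norm_I, mul_one, Complex.norm_real, Real.norm_eq_abs,
      abs_of_pos (by linarith)]
  have ha1 : 1 ≤ ‖a‖ := by rw [ha_norm]; exact ht
  obtain ⟨h1, h2⟩ := hB a ha1
  rw [ha_norm] at h1 h2
  -- Taylor at `a` with real increment `u`
  have hM : ‖a‖ + ‖(u : ℂ)‖ ≤ 2 * t := by
    rw [ha_norm, Complex.norm_real, Real.norm_eq_abs, abs_of_nonneg hu]; linarith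
  have h3 := norm_eval_add_sub_sub_le p (M := 2 * t) (by linarith) hM
  rw [Complex.norm_real, Real.norm_eq_abs, abs_of_nonneg hu, mul_pow] at h3
  have hx : (u : ℂ) + t * I = a + u := by rw [ha]; ring
  rw [hx]
  -- the main terms
  have hpow : ∀ n : ℕ, a ^ n = ((t ^ n : ℝ) : ℂ) * I ^ n := by
    intro n; rw [ha, mul_pow]; push_cast; ring
  have hre1 : (α * a ^ D).re = (α * I ^ D).re * t ^ D := by
    rw [hpow, show α * ((t ^ D : ℝ) * I ^ D) = (α * I ^ D) * ((t ^ D : ℝ) : ℂ) by ring,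
      Complex.re_mul_ofReal]
  have hre2 : (p₁ * a ^ (D - 1)).re = (p₁ * I ^ (D - 1)).re * t ^ (D - 1) := by
    rw [hpow, show p₁ * ((t ^ (D - 1) : ℝ) * I ^ (D - 1)) = (p₁ * I ^ (D - 1)) * ((t ^ (D - 1) : ℝ) : ℂ)
      by ring, Complex.re_mul_ofReal]
  have hre3 : ((D : ℂ) * α * a ^ (D - 1) * u).re = D * (α * I ^ (D - 1)).re * u * t ^ (D - 1) := by
    rw [hpow, show (D : ℂ) * α * ((t ^ (D - 1) : ℝ) * I ^ (D - 1)) * u =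
      (α * I ^ (D - 1)) * ((D * u * t ^ (D - 1) : ℝ) : ℂ) by push_cast; ring, Complex.re_mul_ofReal]
    ring
  -- the error
  set E₁ : ℂ := p.eval a - α * a ^ D - p₁ * a ^ (D - 1) with hE₁
  set E₂ : ℂ := p.derivative.eval a - (D : ℂ) * α * a ^ (D - 1) with hE₂
  set R : ℂ := p.eval (a + u) - p.eval a - p.derivative.eval a * u with hR
  have hdecomp : (p.eval (a + u)).re - ((α * I ^ D).re * t ^ D +
      ((p₁ * I ^ (D - 1)).re + D * (α * I ^ (D - 1)).re * u) * t ^ (D - 1)) =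
      (E₁ + E₂ * u + R).re := by
    have : p.eval (a + u) = α * a ^ D + p₁ * a ^ (D - 1) + (D : ℂ) * α * a ^ (D - 1) * u +
        (E₁ + E₂ * u + R) := by
      simp only [hE₁, hE₂, hR]; ring
    rw [this]
    simp only [Complex.add_re]
    rw [hre1, hre2, hre3]
    ring
  rw [hdecomp]
  have hE₂u : ‖E₂ * u‖ ≤ B * t ^ (D - 2) * u := by
    rw [norm_mul, Complex.norm_real, Real.norm_eq_abs, abs_of_nonneg hu]
    exact mul_le_mul_of_nonneg_right h2 hu
  have hRle : ‖R‖ ≤ B₂ * t ^ (D - 2) * u ^ 2 := by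
    refine h3.trans (le_of_eq ?_)
    rw [hB₂]; ring
  have hu1 : u ≤ (1 + u) ^ 2 := by nlinarith
  have hu2 : u ^ 2 ≤ (1 + u) ^ 2 := by nlinarith
  have hu3 : (1 : ℝ) ≤ (1 + u) ^ 2 := by nlinarith
  have htD : 0 ≤ t ^ (D - 2) := by positivity
  calc |(E₁ + E₂ * u + R).re| ≤ ‖E₁ + E₂ * u + R‖ := Complex.abs_re_le_norm _
    _ ≤ ‖E₁‖ + ‖E₂ * u‖ + ‖R‖ := by
        refine (norm_add_le _ _).trans ?_; linarith [norm_add_le E₁ (E₂ * u)]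
    _ ≤ B * t ^ (D - 2) + B * t ^ (D - 2) * u + B₂ * t ^ (D - 2) * u ^ 2 := by linarith
    _ ≤ B * t ^ (D - 2) * (1 + u) ^ 2 + B * t ^ (D - 2) * (1 + u) ^ 2 +
          B₂ * t ^ (D - 2) * (1 + u) ^ 2 := by
        have hBt : 0 ≤ B * t ^ (D - 2) := by positivity
        have hB₂t : 0 ≤ B₂ * t ^ (D - 2) := by positivity
        nlinarith
    _ = (B + B + B₂) * (1 + u) ^ 2 * t ^ (D - 2) := by ring

/-- If `Re(lc i^D) = 0` (`lc ≠ 0`, `D ≥ 1`) then `lc i^{D-1}` is a nonzero real: `Re(lc i^{D-1}) ≠ 0`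
(`lc i^D = (lc i^{D-1}) i`). [folklore] -/
theorem re_leadingCoeff_mul_I_pow_pred_ne_zero {α : ℂ} (hα : α ≠ 0) {D : ℕ} (hD : 1 ≤ D)
    (hX : (α * I ^ D).re = 0) : (α * I ^ (D - 1)).re ≠ 0 := by
  have hD' : D = (D - 1) + 1 := by omega
  have h1 : α * I ^ D = (α * I ^ (D - 1)) * I := by
    conv_lhs => rw [hD', pow_succ]
    ring
  rw [h1, Complex.mul_I_re] at hX
  intro hre
  have hzero : α * I ^ (D - 1) = 0 :=
    Complex.ext (by rw [Complex.zero_re]; exact hre) (by rw [Complex.zero_im]; linarith)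
  rcases mul_eq_zero.1 hzero with h | h
  · exact hα h
  · exact Complex.I_ne_zero (pow_eq_zero_iff (by
      intro h0; rw [h0, pow_zero] at h; exact one_ne_zero h) |>.1 h)

/-- `(a log m + b)² ≤ δ m` eventually (`δ > 0`). [folklore] -/
theorem eventually_mul_log_add_sq_le (a b : ℝ) {δ : ℝ} (hδ : 0 < δ) :
    ∀ᶠ m : ℕ in atTop, (a * Real.log m + b) ^ 2 ≤ δ * m := by
  have h1 : Tendsto (fun m : ℕ => Real.log m ^ 2 / (1 * (m : ℝ) + 0)) atTop (𝓝 0) :=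
    (Real.tendsto_pow_log_div_mul_add_atTop 1 0 2 one_ne_zero).comp tendsto_natCast_atTop_atTop
  have hε : 0 < δ / (4 * a ^ 2 + 4) := by positivity
  have h2 := h1.eventually (eventually_le_nhds hε)
  have h3 : ∀ᶠ m : ℕ in atTop, 4 * b ^ 2 / δ ≤ m := tendsto_natCast_atTop_atTop.eventually_ge_atTop _
  filter_upwards [h2, h3, eventually_ge_atTop 1] with m hm hm3 hm1
  have hm0 : (0 : ℝ) < m := by exact_mod_cast hm1
  rw [one_mul, add_zero, div_le_iff₀ hm0] at hm
  rw [div_le_iff₀ hδ] at hm3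
  have hsq : (a * Real.log m + b) ^ 2 ≤ 2 * a ^ 2 * Real.log m ^ 2 + 2 * b ^ 2 := by
    nlinarith [sq_nonneg (a * Real.log m - b)]
  have h4 : 2 * a ^ 2 * (δ / (4 * a ^ 2 + 4) * m) ≤ δ / 2 * m := by
    rw [show 2 * a ^ 2 * (δ / (4 * a ^ 2 + 4) * m) = (2 * a ^ 2 / (4 * a ^ 2 + 4)) * (δ * m) by ring,
      show δ / 2 * m = (1 / 2) * (δ * m) by ring]
    refine mul_le_mul_of_nonneg_right ?_ (by positivity)
    rw [div_le_iff₀ (by positivity)]; nlinarith [sq_nonneg a]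
  nlinarith [sq_nonneg a, Real.log_natCast_nonneg m]

end Summit.Schanuel.Schanuel.Theorems

end
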